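import Summits.BirchSwinnertonDyer.BirchSwinnertonDyer.Theses.KatoDescentTamePotSupersingular
import Summits.BirchSwinnertonDyer.Rank1Residual.Additive.FouquetWanLocus
import Literature.NumberTheory.EllipticCurves.PAdicBSD
import HarnessLib

/-!
# Route `KatoDescentTamePotSupersingular` (rung K8, sub-rung B4 (t′), cell `bsd-potss`): DEFINITIONS for the
# Fouquet-2025 congruence-transport road to the crux `TameLowerHalfRankZero` (item stmt-BirchSwinnertonDyer-19981)
# — census predicates at a general odd `p` and two hypothesis SHAPES over the interface `KMC` (nothing asserted)

O. Fouquet, *The equivariant Tamagawa number conjectures for modular motives with coefficients in Hecke algebras*,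
Tunisian J. Math. 7 (2025) 791–829 (= arXiv:2501.07105; PUBLISHED), Thm 4.1 (= Thm 1.7): for an odd prime `p`
and a residual representation `ρ̄` with (Ass. 2.9) `im ρ̄ ⊇ SL₂(𝔽_p)` and, if `ρ̄|G_ℚₚ` is an extension of `ψ`
by `χ`, `χψ⁻¹ ∉ {1, ω⁻¹}`, and (Ass. 3.4) conditions at the primes `ℓ ∈ Σ ∖ Σ(ρ̄)` of the tame level,
Kato's Iwasawa main conjecture (zeta-element form, cyclotomic `ℤ_p`-extension) holds at ONE motivic point
of the local `p`-adic Hecke algebra `T^Σ_𝔪ρ̄` iff it holds at ALL of them; Thm 1.7 (2): at a point with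
non-vanishing `L`-value the `p`-part of the Tamagawa number conjecture follows. NO hypothesis on the
reduction at `p` (the paper's §4.2.2 is additive at `5`). The b2b cell typed this at `p = 3` only
(`Rank1Residual/O5/O5FouquetTransport.lean`: `FouquetEligibleThree`, `IsCongruentModThree`,
`FouquetCongruenceTransportShapeThree`, …); this file gives the general-`p` census predicates and the two
SHAPES the (t′) road at `p ≥ 5` consumes (seat bsd-potss-k8t-c2 g3, memo
`HOME/k8t-c2/FINDING-19981-fouquet2025-k8t-c2-g3.md`, evidence on the item):

* `IsCongruentModP p W X` — `a_ℓ(W) ≡ a_ℓ(X) (mod p)` off `p·N_W·N_X` (screen/Sturm-certifiable per pair);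
* `FouquetEligibleAt p W` — Ass. 3.4 on the unramified Steinberg primes `LR(W) = {ℓ ‖ N_W : p ∣ v_ℓ(Δ_W)}`
  (reading of b2b harvest E87 §2.3–2.4, verbatim the `p = 3` predicate with `3 ↦ p`);
* `FouquetLevelCompatibleAt p W G` — every bad prime `q ≠ p` of the seed divides `N_W` (strict `Σ`);
* `SubLIIstarFive W` — the census cell `p = 5`, Kodaira II* (`v₅(Δ_min) = 10`, `e = 6`) with `v₅(c₄) = 4`:
  by harvest-2 E94's canonical-subgroup character (`a = (e − w − m(p−1))/e = −3 ≡ 1 (mod 4)`) the UNIQUE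
  (t′) cell on which `ρ̄|G_ℚ₅ ≅ (ω·unr, ∗; 0, unr)` has ORDINARY shape (so Ass. 2.9 (2) holds and a
  `5`-ordinary seed can be congruent to `W`; census: all 335 certified good-ordinary partners of (t′) rows
  sit on this cell);
* SHAPE `FouquetTransportShape KMC` — Thm 4.1 (1)⇒(2) at `p ≥ 5` from a level-compatible congruent elliptic
  point, on the two local conditions under which Ass. 2.9 (2) is verified in the memo (`LocIrr`, or the
  ordinary cell `SubLIIstarFive` at `p = 5`);
* SHAPE `OrdinarySeedReadsKMC KMC` — Kato 2004 §17.13 (p. 280; tree skeleton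
  `Kato2004.lengthAt_eq_of_conj17_6_of_skeleton`): at a good ORDINARY `p ≥ 5` with `ρ_{G,p^∞}` onto, the
  Greenberg–Mazur main conjecture in `Λ` — exactly the conclusion of the tree's Skinner–Urban fact bsd.S21
  `skinner_urban_main_conjecture` (Thm 3.6.9), whose hypotheses are repeated as antecedents — reads as
  Kato's Conj. 12.10 for `(G, p)`, i.e. `KMC G p`.

Every `def` is a predicate with a body or a `Prop`-valued function of the interface variable `KMC`
consumed ONLY as an explicit hypothesis (as `FouquetWanClaimShape KMC`); nothing is asserted, no Literature
fact is minted, the item is not closed by anything here.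

References: [Fouquet2025EquivariantTNC] Thm 4.1, Thm 1.7, Ass. 2.9 (p. 15), Ass. 3.4 (pp. 22–23);
[Kato2004Asterisque] Conj. 12.10 (p. 224), §17.13 (p. 280); [SkinnerUrban2014] Thm 3.6.4 (p. 43), Thm 3.6.9 (p. 45).
-/

set_option autoImplicit false
-- sibling precedent (`KatoDescentTamePotSupersingularAssembly.lean`): the directory name repeats the summit name
set_option linter.dupNamespace false

noncomputable section

open scoped Classical

namespace Summit.BirchSwinnertonDyer.BirchSwinnertonDyer.Theorems

open WeierstrassCurve Literature.NumberTheory.EllipticCurves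
  Literature.NumberTheory.EllipticCurves.ModularForms
  Literature.NumberTheory.EllipticCurves.Rank1Residual
  Literature.NumberTheory.EllipticCurves.Rank1Residual.Typed
  Summit.BirchSwinnertonDyer.Rank1Residual.Additive
  Summit.BirchSwinnertonDyer.Rank1Residual

/-! ## §1 Census predicates at a general prime `p` -/

/-- **Mod-`p` congruence of traces** away from `p·N_W·N_X`: `a_ℓ(W) ≡ a_ℓ(X) (mod p)` for every prime
`ℓ ∤ p N_W N_X` (so `ρ̄_W ≅ ρ̄_X` when `W[p]` is irreducible: Brauer–Nesbitt + Chebotarev). The `p = 3` case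
is `O5.IsCongruentModThree`. Census object: cc-eng-2's CONG/X5E link tables (screen at small `ℓ`, certificate
by Sturm bound or by an explicit `E[p]`-isomorphism). [folklore] -/
def IsCongruentModP (p : ℕ) (W X : WeierstrassCurve ℚ) [W.IsElliptic] [W.IsGloballyMinimal]
    [X.IsElliptic] [X.IsGloballyMinimal] : Prop :=
  ∀ ℓ : ℕ, ℓ.Prime → ¬ (ℓ ∣ p * W.conductorNorm ℤ * X.conductorNorm ℤ) →
    ((W.LFunction ℓ : ℤ) : ZMod p) = ((X.LFunction ℓ : ℤ) : ZMod p)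

/-- **Fouquet's Ass. 3.4 on the unramified Steinberg primes of `W` at `p`** (reading of b2b harvest E87
§2.3–2.4, the tree's `O5.FouquetEligibleThree` with `3 ↦ p`): at every prime `q ≠ p` of multiplicative
reduction where `W[p]` is UNRAMIFIED (`p ∣ v_q(Δ_min)`, Tate): `q` is odd (Ass. 3.4: "`ℓ ∤ p` in `Σ ∖ Σ(ρ̄)`
is odd"), and if `q ≡ 1 (mod p)` then `u_q := Δ_min · q^{-v_q(Δ_min)}` is NOT a `p`-th power mod `q`
(condition (5b): `ρ̄(Frob_q)` not diagonalizable); `q ≢ ±1` is (2) and `q ≡ −1` is (3b) with Iwahori level.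
Every additive prime `ℓ ≠ p` of `W` has `ρ̄` ramified for `p ≥ 5` (inertia image of order prime to `p`), so
lies in `Σ(ρ̄)` and carries no condition. A census-decidable predicate; nothing asserted.
[cite: Fouquet2025EquivariantTNC, Ass. 3.4 (pp. 22–23) and Thm 1.7 (hypothesis on U^(p))] -/
def FouquetEligibleAt (p : ℕ) (W : WeierstrassCurve ℚ) [W.IsGloballyMinimal] : Prop :=
  ∀ (q : ℕ) [Fact q.Prime], q ≠ p → W.HasMultiplicativeReductionAtPrime q →
    p ∣ padicValInt q W.minimalDiscriminantInt →
      q ≠ 2 ∧ (q % p = 1 →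
        ¬ ∃ x : ZMod q, x ^ p =
          ((W.minimalDiscriminantInt / (q : ℤ) ^ padicValInt q W.minimalDiscriminantInt : ℤ) : ZMod q))

/-- **Level compatibility of the seed (strict form, `Σ = primes(p·N_W)`)**: every prime `q ≠ p` of bad
reduction of `G` divides `N_W`, so `G` is a motivic point of `T^Σ_𝔪ρ̄` for the tame level of `W` without
enlarging `Σ` (the `p = 3` case is `O5.FouquetLevelCompatibleThree`). [cite: Fouquet2025EquivariantTNC, §2.4.1 (p. 15) and Thm 4.1] -/
def FouquetLevelCompatibleAt (p : ℕ) (W G : WeierstrassCurve ℚ) [W.IsElliptic] [G.IsElliptic] : Prop :=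
  ∀ q : ℕ, q.Prime → q ≠ p → (q : ℤ) ∣ G.conductorNorm ℤ → (q : ℤ) ∣ W.conductorNorm ℤ

/-- **The census cell `L_{II*,5}`'s local datum**: `p = 5`, Kodaira type II* (`v₅(Δ_min) = 10`, so
`e = 12/gcd(12,10) = 6`, tame potentially supersingular since `5 ≡ 2 (mod 3)`) with `v₅(c₄) = 4`, the minimal
value the type allows. By harvest-2 E94 (valuation criterion, typed as `CanonicalSubgroupCriterion`) this is
the canonical-subgroup (locally REDUCIBLE) sub-case of II* at `5`, and by E94 §2.4's character recipe
(`a = (e − w − m(p−1))/e` with `(e, w, m) = (6, 4, 5)`, `a = −3 ≡ 1 (mod 4)`) the stable line carries `ω·unr`: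
ORDINARY local shape — confirmed by the census (every certified good-ordinary mod-5 partner of a (t′) row
lies on this cell; e.g. `40200g1 ≡ 1608a1`, `50575q1 ≡ 2023b1`). On a globally minimal `W`, `W.c₄` is the
minimal `c₄`. A decidable predicate; nothing asserted. [folklore] -/
def SubLIIstarFive (W : WeierstrassCurve ℚ) [W.IsElliptic] [W.IsGloballyMinimal] : Prop :=
  padicValInt 5 W.minimalDiscriminantInt = 10 ∧ padicValRat 5 W.c₄ = 4

/-! ## §2 The two hypothesis SHAPES over the interface `KMC` (consumed only as explicit hypotheses) -/

section Shapes

/-- **SHAPE — Fouquet 2025 Thm 4.1 (1)⇒(2) at `p ≥ 5` along a mod-`p` congruence with an elliptic point.**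
For `W` additive at `p` with `W[p]` irreducible (X4) and `ρ̄_{W,p}` onto (Ass. 2.9 (1)), the local condition
Ass. 2.9 (2) in one of the two forms verified in the seat's memo (`LocIrr W p`, or the ordinary cell
`SubLIIstarFive W` at `p = 5`), Ass. 3.4 on `LR(W)` (`FouquetEligibleAt`), and a level-compatible elliptic
curve `G` with `a_ℓ(G) ≡ a_ℓ(W) (mod p)` off `p N_W N_G` (hence `G[p] ≅ W[p]`, both points of `T^Σ_𝔪ρ̄`):
`KMC G p → KMC W p`, where `KMC E p` reads "Kato's Conj. 12.10 for `(f_E, p)` over the cyclotomic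
`ℤ_p`-extension" (= Fouquet's conj. 1.4/2.7 at the point; formulation joint J-F25 of b2b E87 §5.2).
PUBLISHED theorem read as a hypothesis shape (the tree has no Hecke algebra `T^Σ_𝔪ρ̄`); NOT a Literature fact.
[cite: Fouquet2025EquivariantTNC, Thm 4.1 (pp. 24–25) and Thm 1.7 (p. 7)] [cite: Kato2004Asterisque, Conj. 12.10 (p. 224)] -/
def FouquetTransportShape
    (KMC : ∀ (W : WeierstrassCurve ℚ) [W.IsElliptic] [W.IsGloballyMinimal] (p : ℕ), Prop) : Prop :=
  ∀ (W G : WeierstrassCurve ℚ) [W.IsElliptic] [W.IsGloballyMinimal] [G.IsElliptic] [G.IsGloballyMinimal]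
    (p : ℕ) [Fact p.Prime], 5 ≤ p → ClassX4 W p → Surj W p → (LocIrr W p ∨ (p = 5 ∧ SubLIIstarFive W)) →
    FouquetEligibleAt p W → IsCongruentModP p W G → FouquetLevelCompatibleAt p W G → KMC G p → KMC W p

/-- **SHAPE — an ORDINARY seed: the Greenberg–Mazur main conjecture in `Λ` reads as `KMC`** (Kato 2004
§17.13, p. 280: "Conj. 17.6 becomes a consequence of Conj. 12.10" and, over the same exact sequence
(17.13.1)–(17.13.4), conversely — tree skeleton `Kato2004.lengthAt_eq_of_conj17_6_of_skeleton`). Antecedents =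
the hypotheses of the tree's Skinner–Urban fact bsd.S21 (`G` good ordinary at `p ≥ 5`, `G[p]` irreducible, a
ramified Steinberg prime `Ram G p`) plus `ρ_{G,p^∞}` onto (Kato's (12.5.2), the integral clause), plus that
fact's CONCLUSION for every cyclotomic datum (so a consumer discharges it by `skinner_urban_main_conjecture`,
S–U Thm 3.6.9 / 3.6.4 + Kato 17.4): then `KMC G p`. A reading shape; NOT a Literature fact.
[cite: Kato2004Asterisque, §17.13 (p. 280) and Conj. 17.6 (p. 274)] [cite: SkinnerUrban2014, Thm. 3.6.9 (p. 45)] -/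
def OrdinarySeedReadsKMC
    (KMC : ∀ (W : WeierstrassCurve ℚ) [W.IsElliptic] [W.IsGloballyMinimal] (p : ℕ), Prop) : Prop :=
  ∀ (G : WeierstrassCurve ℚ) [G.IsElliptic] [G.IsGloballyMinimal] (p : ℕ) [Fact p.Prime],
    5 ≤ p → GoodOrd G p → Irr G p → Ram G p → (∀ n : ℕ, G.HasSurjectiveModNGaloisRep (p ^ n : ℕ)) →
    (∀ (κ : ZpExtension ℚ p) (γ : Field.absoluteGaloisGroup ℚ) (N : ℕ) [NeZero N]
        (f : CuspForm (CongruenceSubgroup.Gamma0 N) 2),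
        skinner_urban_main_conjecture G p (κ := κ) (γ := γ) (f := f)) →
    KMC G p

end Shapes

/-! ## §3 Fouquet's Ass. 2.9 (2) EXACTLY — no `p`-torsion abscissa in `ℚ_p` — and the transport shape
over it (seat bsd-potss-k8t-c2 g4; memo `HOME/k8t-c2/FINDING-19981-ass29-k8t-c2-g4.md`, kit j253026) -/

/-- **Fouquet's Assumption 2.9 (2) at `(W, p)` as an EXACT census predicate: the `p`-division polynomial
`ΨSq_p` of `W` has no root in `ℚ_p`**, i.e. no non-zero `p`-torsion point of `W` has a `ℚ_p`-rational
abscissa (the roots of `ΨSq_n` are exactly the abscissae of the non-zero `n`-torsion: tree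
`WeierstrassCurve.zsmul_some_eq_zero_iff_eval_ΨSq`). For an odd prime `p` and `ρ̄ = W[p]|G_ℚₚ` — ANY
reduction type — this is EQUIVALENT to Ass. 2.9 (2) «if `ρ̄|G_ℚₚ` is an extension
`0 → χ → ρ̄|G_ℚₚ → ψ → 0` then `χψ⁻¹ ≠ 1` and `χψ⁻¹ ≠ χ̄_cyc⁻¹`» by an elementary argument (seat g4):
`χψ = det ρ̄ = ω`, so `χψ⁻¹ = χ²ω⁻¹ ∈ {1, ω⁻¹}` iff `χ² ∈ {ω, 1}`; `χ² = ω` is impossible (a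
`k̄^×`-valued character of `G_ℚₚ` is tame, of order dividing `p − 1` on inertia, and `p − 1` is even);
hence 2.9 (2) FAILS iff some `G_ℚₚ`-stable line of `W[p]` carries a `{±1}`-valued character, iff some
`P ∈ W[p] ∖ 0` has `σP = ±P` for every `σ ∈ G_ℚₚ`, iff `x(P) ∈ ℚ_p`. It REPLACES the seat-g3
sufficient disjunct `LocIrr W p ∨ (p = 5 ∧ SubLIIstarFive W)` of `FouquetTransportShape`: locally
irreducible rows satisfy it vacuously; on canonical-subgroup rows (sub-character `ω^a·μ`, harvest-2 E94)
it is the «Frobenius test» (`ω^a μ` is `{±1}`-valued iff `2a ≡ 0 (mod p−1)` and `μ² = 1`) AND the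
split sub-case (a second stable line `ω^{1−a}μ⁻¹`, `{±1}`-valued iff `2a ≡ 2` and `μ² = 1` — e.g. a
SPLIT row of the ordinary-shape cell `SubLIIstarFive`, `a ≡ 1`, with `μ = ±1` would violate 2.9 (2);
the census kit j253026 over the 5 555 (t′) rank-`0` rows at `p ≥ 5`, N < 5·10⁵, finds no split row and
failures exactly on part of the `(5; II)` and `(5; IV*)` canonical-subgroup rows — numbers in the memo).
A decidable predicate of the model over `ℚ_p`; nothing asserted.
[cite: Fouquet2025EquivariantTNC, Ass. 2.9 (p. 15)] -/
def FouquetGenericAt (p : ℕ) [Fact p.Prime] (W : WeierstrassCurve ℚ) : Prop :=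
  ∀ x : ℚ_[p], ((W.baseChange ℚ_[p]).ΨSq (p : ℤ)).eval x ≠ 0

section ShapesExact

/-- **SHAPE — Fouquet 2025 Thm 4.1 (1)⇒(2) at `p ≥ 5` along a mod-`p` congruence with an elliptic point,
Ass. 2.9 (2) in its EXACT form `FouquetGenericAt p W`** (seat g4's refinement of `FouquetTransportShape`:
same antecedents — `W` additive at `p` with `W[p]` irreducible (`ClassX4`), `ρ̄_{W,p}` onto (Ass. 2.9 (1)),
Ass. 3.4 on `LR(W)` (`FouquetEligibleAt`), a level-compatible elliptic curve `G` with
`a_ℓ(G) ≡ a_ℓ(W) (mod p)` off `p N_W N_G` — except that the local clause is now EXACTLY the paper's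
2.9 (2), neither weaker nor stronger, and cell-free: every additive row at `p ≥ 5`, not only (t′)).
Conclusion `KMC G p → KMC W p` over the interface `KMC` («Kato's Conj. 12.10 for `(f_E, p)` over the
cyclotomic `ℤ_p`-extension»). PUBLISHED theorem read as a hypothesis shape (no Hecke algebra `T^Σ_𝔪ρ̄` in
the tree); NOT a Literature fact; consumed only as an explicit hypothesis.
[cite: Fouquet2025EquivariantTNC, Thm 4.1 (pp. 24–25), Thm 1.7 (p. 7), Ass. 2.9 (p. 15), Ass. 3.4 (pp. 22–23)]
[cite: Kato2004Asterisque, Conj. 12.10 (p. 224)] -/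
def FouquetTransportShapeExact
    (KMC : ∀ (W : WeierstrassCurve ℚ) [W.IsElliptic] [W.IsGloballyMinimal] (p : ℕ), Prop) : Prop :=
  ∀ (W G : WeierstrassCurve ℚ) [W.IsElliptic] [W.IsGloballyMinimal] [G.IsElliptic] [G.IsGloballyMinimal]
    (p : ℕ) [Fact p.Prime], 5 ≤ p → ClassX4 W p → Surj W p → FouquetGenericAt p W →
    FouquetEligibleAt p W → IsCongruentModP p W G → FouquetLevelCompatibleAt p W G → KMC G p → KMC W p

end ShapesExact

end Summit.BirchSwinnertonDyer.BirchSwinnertonDyer.Theorems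

end
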